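import Literature.MathematicalPhysics.QuantumFieldTheory.Balaban1983to89.B7Ineq199General
import Literature.Analysis.Complex.RungeUnits
import Literature.Analysis.Calculus.ExpLocalLieSubalgebra
import Mathlib.Analysis.CStarAlgebra.Classes
import HarnessLib

/-!
# T⁴ programme, row NE7 — THE MULTIPLICATIVE LETTERS OF ONE PERTURBATIVE GAUGE STEP `y ↦ e^{τ(y)}` WITH A LARGE BUT SLOWLY VARYING
# GAUGE FUNCTION: the re-gauged link `e^{T}·e^{A}·e^{−T′}` is `1 + O(‖A − (T′ − T)‖ + (‖T‖ + ‖T′ − T‖)·‖T′ − T‖)` — NO `‖T‖²` TERM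
# (`NE7GaugeStepLetters`)

Cell `pub-balaban`, lineage `t4-ne7-p1` (CRUX PROVER NE7 #1 = OWNER of row NE7), gen 73; brick (J) of the REP♭ sup-member road
`t4/b2b-balaban-t4-ne7-p1-g73/REP-FLAT-ROAD-v2.md` §2 (s5).  WHY.  In the level-`j` step of the multi-level sup induction the gauge
function `τ` of the linear Landau step is small only ABSOLUTELY (`‖τ‖ = O(L·C′δ)`, the size of a block potential), while its lattice
gradient `T′ − T = τ(y+e_κ) − τ(y)` and the defect `A − (T′ − T)` are `O(δ∕L^j)`.  The new link `e^{τ(y)} e^{A(y,κ)} e^{−τ(y+e_κ)}` must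
therefore be estimated WITHOUT the generic BCH error `(‖T‖ + ‖A‖ + ‖T′‖)²`, which contains the non-decaying self-term `‖T‖²`.  The exact
identity `e^{T}e^{A}e^{−T′} − 1 = e^{T}(e^{A} − e^{−T}e^{T′})e^{−T′}` (isometric for skew `T, T′`) and Duhamel's second-order expansion
`e^{T+D} = e^{T} + D + O((e^{2‖T‖+‖D‖} − 1)‖D‖)` (tree: `B7Ineq199General.norm_exp_add_sub_exp_sub_le`, whose error VANISHES WITH `D`) give
**`‖e^{T}e^{A}e^{−T′} − 1‖ ≤ 2‖A − (T′−T)‖ + 8(‖T‖ + ‖T′−T‖)‖T′−T‖`** for `‖A‖, ‖T‖, ‖T′−T‖ ≤ 1∕4` (§2).  §1: the conjugation identities;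
§3: the CORNER LETTER `‖u − u′‖ ≤ ‖u·h·u′⁻¹ − 1‖ + ‖h − 1‖` (unitaries), by which the oscillation of the step's gauge function between
neighbouring block corners is read off the straight corner-to-corner transporter of the re-gauged field.

HONEST FRAMING (page 1): [folklore] Banach-∕C*-algebra calculus of `exp`; 0 def, 0 sorry; nothing of Bałaban's is used or claimed; REP♭
NOT proved here; (APE) NOT proved; NE7 NOT PRINTED ∕ NOT PROVED; spine 0∕9; finite T⁴ rung (B)+1 — NOT infinite volume, NOT mass gap, NOT
BetaPertH, NOT Clay.  PLACEMENT: our lemma, under `Summits/QuantumFields/BalabanUV/`.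
Continuum YM on T⁴ ⇐ BetaPertH ∧ nine spine estimates (0/9 proved); BetaPertH ⇐ (D1) ∧ (D4) ∧ CAP+tail; G-an2-4 gates asym, D1 and NE2/3/4.
-/

set_option autoImplicit false

open NormedSpace

namespace Summit.QuantumFields.BalabanUV.T4Continuum.NE7GaugeStepLetters

open Literature.MathematicalPhysics.QuantumFieldTheory.Balaban1983to89
open B7Prop2Explicit (unitaryUnits mem_unitaryUnits)

noncomputable section

/-! ## §1 Second-order calculus: `e^{−T}e^{T+D} − e^{D}` has no `‖T‖²` term -/

section Banach

/-- `e^x − 1 ≤ 2x` on `[0, 3∕4]` (the numeric range of this file). [folklore] -/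
private theorem real_exp_sub_one_le_two_mul {x : ℝ} (h0 : 0 ≤ x) (h1 : x ≤ 3 / 4) : Real.exp x - 1 ≤ 2 * x := by
  have h := Real.abs_exp_sub_one_sub_id_le (x := x) (by rw [abs_of_nonneg h0]; linarith)
  have h' := (abs_le.mp h).2
  nlinarith

variable {𝔸 : Type*} [NormedRing 𝔸] [NormedAlgebra ℂ 𝔸] [CompleteSpace 𝔸] [NormOneClass 𝔸]

/-- **THE TWISTED DIFFERENCE QUOTIENT**: `‖e^{−T}e^{T+D} − e^{D}‖ ≤ ‖D‖·((e^{‖T‖} − 1) + e^{‖T‖}(e^{‖T‖+‖T+D‖} − 1) + (e^{‖D‖} − 1))` —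
every term carries a factor `‖D‖`; there is NO pure-`T` term (Duhamel). [folklore] -/
theorem norm_exp_neg_mul_exp_add_sub_exp_le (T D : 𝔸) :
    ‖exp (-T) * exp (T + D) - exp D‖
      ≤ ‖D‖ * ((Real.exp ‖T‖ - 1) + Real.exp ‖T‖ * (Real.exp (‖T‖ + ‖T + D‖) - 1) + (Real.exp ‖D‖ - 1)) := by
  -- `e^{T+D} = e^{T} + D + E₁`, `e^{D} = 1 + D + E₂`
  set E₁ := exp (T + D) - exp T - D with hE₁
  set E₂ := exp D - 1 - D with hE₂
  have h1 : ‖E₁‖ ≤ (Real.exp (‖T‖ + ‖T + D‖) - 1) * ‖D‖ := B7Ineq199General.norm_exp_add_sub_exp_sub_le T D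
  have h2 : ‖E₂‖ ≤ (Real.exp ‖D‖ - 1) * ‖D‖ := by
    have h := B7Ineq199General.norm_exp_add_sub_exp_sub_le (0 : 𝔸) D
    rwa [zero_add, exp_zero, norm_zero, zero_add] at h
  have hid : exp (-T) * exp (T + D) - exp D = (exp (-T) - 1) * D + exp (-T) * E₁ - E₂ := by
    have h := Literature.Analysis.Calculus.exp_neg_mul_exp T
    have e1 : exp (-T) * E₁ = exp (-T) * exp (T + D) - 1 - exp (-T) * D := by rw [hE₁, mul_sub, mul_sub, h]
    rw [e1, hE₂]
    noncomm_ring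
  letI : NormedAlgebra ℚ 𝔸 := NormedAlgebra.restrictScalars ℚ ℝ 𝔸
  have hT1 : ‖exp (-T) - 1‖ ≤ Real.exp ‖T‖ - 1 := by
    have h := Literature.Analysis.Calculus.norm_exp_sub_one_le (-T)
    rwa [norm_neg] at h
  have hT : ‖exp (-T)‖ ≤ Real.exp ‖T‖ := by
    calc ‖exp (-T)‖ = ‖(exp (-T) - 1) + 1‖ := by rw [sub_add_cancel]
      _ ≤ ‖exp (-T) - 1‖ + ‖(1 : 𝔸)‖ := norm_add_le _ _
      _ ≤ (Real.exp ‖T‖ - 1) + 1 := add_le_add hT1 (by rw [norm_one])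
      _ = Real.exp ‖T‖ := by ring
  rw [hid]
  have hD := norm_nonneg D
  have he1 : 0 ≤ Real.exp (‖T‖ + ‖T + D‖) - 1 := by
    have := Real.one_le_exp (show 0 ≤ ‖T‖ + ‖T + D‖ by positivity); linarith
  calc ‖(exp (-T) - 1) * D + exp (-T) * E₁ - E₂‖
      ≤ ‖(exp (-T) - 1) * D‖ + ‖exp (-T) * E₁‖ + ‖E₂‖ := norm_sub_le_of_le (norm_add_le _ _) le_rfl
    _ ≤ (Real.exp ‖T‖ - 1) * ‖D‖ + Real.exp ‖T‖ * ((Real.exp (‖T‖ + ‖T + D‖) - 1) * ‖D‖) + (Real.exp ‖D‖ - 1) * ‖D‖ := by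
        refine add_le_add (add_le_add ?_ ?_) h2
        · exact (norm_mul_le _ _).trans (mul_le_mul_of_nonneg_right hT1 hD)
        · exact (norm_mul_le _ _).trans (mul_le_mul hT h1 (norm_nonneg _) (Real.exp_pos _).le)
    _ = ‖D‖ * ((Real.exp ‖T‖ - 1) + Real.exp ‖T‖ * (Real.exp (‖T‖ + ‖T + D‖) - 1) + (Real.exp ‖D‖ - 1)) := by ring

/-- **NUMERIC FORM**: for `‖T‖, ‖D‖ ≤ 1∕4`, `‖e^{−T}e^{T+D} − e^{D}‖ ≤ 8(‖T‖ + ‖D‖)‖D‖`. [folklore] -/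
theorem norm_exp_neg_mul_exp_add_sub_exp_le' {T D : 𝔸} (hT : ‖T‖ ≤ 1 / 4) (hD : ‖D‖ ≤ 1 / 4) :
    ‖exp (-T) * exp (T + D) - exp D‖ ≤ 8 * (‖T‖ + ‖D‖) * ‖D‖ := by
  have hT0 := norm_nonneg T
  have hD0 := norm_nonneg D
  have hTD : ‖T + D‖ ≤ ‖T‖ + ‖D‖ := norm_add_le _ _
  have e1 : Real.exp ‖T‖ - 1 ≤ 2 * ‖T‖ := real_exp_sub_one_le_two_mul hT0 (by linarith)
  have e2 : Real.exp (‖T‖ + ‖T + D‖) - 1 ≤ 2 * (2 * ‖T‖ + ‖D‖) := by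
    have hmono : Real.exp (‖T‖ + ‖T + D‖) ≤ Real.exp (2 * ‖T‖ + ‖D‖) := Real.exp_le_exp.mpr (by linarith)
    have h' := real_exp_sub_one_le_two_mul (x := 2 * ‖T‖ + ‖D‖) (by positivity) (by linarith)
    linarith
  have e3 : Real.exp ‖D‖ - 1 ≤ 2 * ‖D‖ := real_exp_sub_one_le_two_mul hD0 (by linarith)
  have eT : Real.exp ‖T‖ ≤ 3 / 2 := by linarith
  have h := norm_exp_neg_mul_exp_add_sub_exp_le T D
  have hbr : (Real.exp ‖T‖ - 1) + Real.exp ‖T‖ * (Real.exp (‖T‖ + ‖T + D‖) - 1) + (Real.exp ‖D‖ - 1) ≤ 8 * (‖T‖ + ‖D‖) := by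
    have he2 : 0 ≤ Real.exp (‖T‖ + ‖T + D‖) - 1 := by
      have := Real.one_le_exp (show 0 ≤ ‖T‖ + ‖T + D‖ by positivity); linarith
    nlinarith
  calc ‖exp (-T) * exp (T + D) - exp D‖ ≤ ‖D‖ * (8 * (‖T‖ + ‖D‖)) := h.trans (mul_le_mul_of_nonneg_left hbr hD0)
    _ = 8 * (‖T‖ + ‖D‖) * ‖D‖ := by ring

/-- `‖e^{A} − e^{D}‖ ≤ 2‖A − D‖` for `‖A‖, ‖D‖ ≤ 1∕4`. [folklore] -/
theorem norm_exp_sub_exp_le_two_mul {A D : 𝔸} (hA : ‖A‖ ≤ 1 / 4) (hD : ‖D‖ ≤ 1 / 4) : ‖exp A - exp D‖ ≤ 2 * ‖A - D‖ := by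
  have h := Literature.Analysis.Complex.norm_exp_sub_exp_le A D
  have hm : Real.exp (max ‖A‖ ‖D‖) ≤ 2 := by
    have h1 : max ‖A‖ ‖D‖ ≤ 1 / 4 := max_le hA hD
    have h2 : Real.exp (max ‖A‖ ‖D‖) ≤ Real.exp (1 / 4) := Real.exp_le_exp.mpr h1
    have h3 := real_exp_sub_one_le_two_mul (x := (1 : ℝ) / 4) (by norm_num) (by norm_num)
    linarith
  calc ‖exp A - exp D‖ ≤ ‖A - D‖ * Real.exp (max ‖A‖ ‖D‖) := h
    _ ≤ ‖A - D‖ * 2 := mul_le_mul_of_nonneg_left hm (norm_nonneg _)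
    _ = 2 * ‖A - D‖ := mul_comm _ _

end Banach

/-! ## §2 The re-gauged link `e^{T} e^{A} e^{−T′}` (C*-algebra: `e^{T}`, `e^{T′}` unitary for skew `T, T′`) -/

section CStar

variable {𝔸 : Type*} [CStarAlgebra 𝔸]

/-- **CONJUGATION IDENTITY**: for unitaries `p, q` and any `E`, `‖p·E·q⋆ − 1‖ = ‖E − p⋆·q‖` (`p E q⋆ − 1 = p (E − p⋆ q) q⋆`). [folklore] -/
theorem norm_unitary_mul_mul_star_sub_one {p q : 𝔸} (hp : p ∈ unitary 𝔸) (hq : q ∈ unitary 𝔸) (E : 𝔸) :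
    ‖p * E * star q - 1‖ = ‖E - star p * q‖ := by
  nontriviality 𝔸
  have h1 : p * star p = 1 := Unitary.mul_star_self_of_mem hp
  have h2 : q * star q = 1 := Unitary.mul_star_self_of_mem hq
  have hid : p * E * star q - 1 = p * (E - star p * q) * star q := by
    rw [mul_sub, sub_mul, show p * (star p * q) * star q = 1 by rw [← mul_assoc, h1, one_mul, h2]]
  rw [hid, CStarRing.norm_mul_mem_unitary _ (Unitary.star_mem hq), CStarRing.norm_mem_unitary_mul _ hp]

/-- **THE GAUGE-STEP LINK LETTER**: for skew-adjoint `T, T′` and any `A` with `‖A‖, ‖T‖, ‖T′ − T‖ ≤ 1∕4`,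
`‖e^{T}·e^{A}·e^{−T′} − 1‖ ≤ 2‖A − (T′ − T)‖ + 8(‖T‖ + ‖T′ − T‖)·‖T′ − T‖` — the new link deviates from `1` by the linear defect
`A − ∇τ` plus a junk carrying the GRADIENT `T′ − T` as a factor (no `‖T‖²` self-term). [folklore] -/
theorem norm_gaugeStep_link_sub_one_le {T T' A : 𝔸} (hT : T ∈ skewAdjoint 𝔸) (hT' : T' ∈ skewAdjoint 𝔸)
    (hA4 : ‖A‖ ≤ 1 / 4) (hT4 : ‖T‖ ≤ 1 / 4) (hD4 : ‖T' - T‖ ≤ 1 / 4) :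
    ‖exp T * exp A * exp (-T') - 1‖ ≤ 2 * ‖A - (T' - T)‖ + 8 * (‖T‖ + ‖T' - T‖) * ‖T' - T‖ := by
  nontriviality 𝔸
  letI : NormedAlgebra ℚ 𝔸 := NormedAlgebra.restrictScalars ℚ ℝ 𝔸
  have hpu : exp T ∈ unitary 𝔸 := exp_mem_unitary_of_mem_skewAdjoint hT
  have hqu : exp T' ∈ unitary 𝔸 := exp_mem_unitary_of_mem_skewAdjoint hT'
  -- `star (e^{T}) = e^{−T}`, `star (e^{T′}) = e^{−T′}`
  have hsT : star (exp T) = exp (-T) := by rw [star_exp, skewAdjoint.mem_iff.mp hT]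
  have hsT' : star (exp T') = exp (-T') := by rw [star_exp, skewAdjoint.mem_iff.mp hT']
  have h1 : ‖exp T * exp A * exp (-T') - 1‖ = ‖exp A - exp (-T) * exp T'‖ := by
    rw [← hsT', norm_unitary_mul_mul_star_sub_one hpu hqu, hsT]
  rw [h1]
  set D := T' - T with hD
  have hTD : T + D = T' := by rw [hD]; abel
  have h2 : ‖exp A - exp D‖ ≤ 2 * ‖A - D‖ := norm_exp_sub_exp_le_two_mul hA4 hD4
  have h3 : ‖exp (-T) * exp (T + D) - exp D‖ ≤ 8 * (‖T‖ + ‖D‖) * ‖D‖ := norm_exp_neg_mul_exp_add_sub_exp_le' hT4 hD4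
  rw [hTD] at h3
  calc ‖exp A - exp (-T) * exp T'‖ ≤ ‖exp A - exp D‖ + ‖exp D - exp (-T) * exp T'‖ := norm_sub_le_norm_sub_add_norm_sub _ _ _
    _ ≤ 2 * ‖A - D‖ + 8 * (‖T‖ + ‖D‖) * ‖D‖ := add_le_add h2 (by rw [norm_sub_rev]; exact h3)

/-! ## §3 The corner letter -/

/-- **THE CORNER LETTER**: for unitaries `u, u′, h`, `‖u − u′‖ ≤ ‖u·h·u′⋆ − 1‖ + ‖h − 1‖` — the difference of the step's gauge values at two
neighbouring block corners is read off the re-gauged corner-to-corner transporter `u·h·u′⋆` and the old one `h`. [folklore] -/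
theorem norm_sub_le_of_transporter {u u' h : 𝔸} (hu : u ∈ unitary 𝔸) (hu' : u' ∈ unitary 𝔸) :
    ‖u - u'‖ ≤ ‖u * h * star u' - 1‖ + ‖h - 1‖ := by
  nontriviality 𝔸
  have hid : u - u' = (u * h * star u' - 1) * u' + u * (1 - h) := by
    rw [sub_mul, mul_assoc (u * h), Unitary.star_mul_self_of_mem hu', mul_one, one_mul, mul_sub, mul_one]
    abel
  rw [hid]
  calc ‖(u * h * star u' - 1) * u' + u * (1 - h)‖ ≤ ‖(u * h * star u' - 1) * u'‖ + ‖u * (1 - h)‖ := norm_add_le _ _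
    _ = ‖u * h * star u' - 1‖ + ‖h - 1‖ := by
        rw [CStarRing.norm_mul_mem_unitary _ hu', CStarRing.norm_mem_unitary_mul _ hu, norm_sub_rev (1 : 𝔸) h]

/-- Units form of the corner letter: `‖u − u′‖ ≤ ‖u·h·u′⁻¹ − 1‖ + ‖h − 1‖` for unitary units. [folklore] -/
theorem norm_sub_le_of_transporter_units {u u' h : 𝔸ˣ} (hu : u ∈ unitaryUnits 𝔸) (hu' : u' ∈ unitaryUnits 𝔸) :
    ‖(u : 𝔸) - u'‖ ≤ ‖((u * h * u'⁻¹ : 𝔸ˣ) : 𝔸) - 1‖ + ‖(h : 𝔸) - 1‖ := by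
  have e : ((u'⁻¹ : 𝔸ˣ) : 𝔸) = star (u' : 𝔸) :=
    Units.inv_eq_of_mul_eq_one_right (Unitary.mul_star_self_of_mem (mem_unitaryUnits.mp hu'))
  rw [Units.val_mul, Units.val_mul, e]
  exact norm_sub_le_of_transporter (mem_unitaryUnits.mp hu) (mem_unitaryUnits.mp hu')

/-- Units form of the link letter: `‖p·E·q⁻¹ − 1‖ = ‖E − p⁻¹·q‖` for unitary units `p, q`. [folklore] -/
theorem norm_conj_units_sub_one {p q : 𝔸ˣ} (hp : p ∈ unitaryUnits 𝔸) (hq : q ∈ unitaryUnits 𝔸) (E : 𝔸) :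
    ‖(p : 𝔸) * E * ((q⁻¹ : 𝔸ˣ) : 𝔸) - 1‖ = ‖E - ((p⁻¹ : 𝔸ˣ) : 𝔸) * q‖ := by
  have ep : ((p⁻¹ : 𝔸ˣ) : 𝔸) = star (p : 𝔸) :=
    Units.inv_eq_of_mul_eq_one_right (Unitary.mul_star_self_of_mem (mem_unitaryUnits.mp hp))
  have eq : ((q⁻¹ : 𝔸ˣ) : 𝔸) = star (q : 𝔸) :=
    Units.inv_eq_of_mul_eq_one_right (Unitary.mul_star_self_of_mem (mem_unitaryUnits.mp hq))
  rw [ep, eq]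
  exact norm_unitary_mul_mul_star_sub_one (mem_unitaryUnits.mp hp) (mem_unitaryUnits.mp hq) E

end CStar

end

end Summit.QuantumFields.BalabanUV.T4Continuum.NE7GaugeStepLetters
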